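import Mathlib.Analysis.SpecialFunctions.Pow.Real
import Mathlib.NumberTheory.ArithmeticFunction.Misc
import Mathlib.Data.List.Prime
import Mathlib.Data.Nat.Factors
import Mathlib.Algebra.Order.BigOperators.Group.List
import Mathlib.Order.Filter.AtTopBot.Basic
import Literature.NumberTheory.Sieve.LargestPrimeFactorCubic
import HarnessLib

/-!
# Irving 2015, Theorem 1.1 — the elementary skeleton of the printed proof (proved steps)

A. J. Irving, *The largest prime factor of `X³ + 2`*, arXiv:1412.0024 = Acta Arith. 171 (2015),
Thm. 1.1, is vendored as the named fact `Irving2015_largestPrimeFactor_cubic`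
(`Literature/NumberTheory/Sieve/LargestPrimeFactorCubic.lean`).  Its proof rests on three inputs
from D. R. Heath-Brown, *The largest prime factor of `X³ + 2`*, Proc. London Math. Soc. (3) 82
(2001) 554–596 (Irving's Lemmas 2.1–2.3: the ideal theory of `ℤ[∛2]`, a Chebyshev-type
"`log^{(1)}`" lemma, and the lower bound `S ≥ (9.2·10⁻⁸ + o(1))X` for a sieve-weighted count of
ideal divisors `KL ∣ n + ∛2`, whose proof is Heath-Brown's `q`-analogue of van der Corput's method
for short Kloosterman sums to factorable moduli) — none of which is in Mathlib or in this tree —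
plus a Mertens estimate `∑_{p ≤ x} ν(p) log p / p = log x + O(1)` for `ν(p) = #{n mod p : p ∣ n³+2}`
and numerical exponential integrals.  Those inputs are NOT restated here (D-0026: no new named
facts).  What this file proves are the ELEMENTARY steps of Irving's deduction, exactly as printed,
so that a later discharge only has to supply the deep inputs:

* `Irving2015.sum_weight_le` — §2 (arXiv pp. 4–5): if `W(a) ≤ min(Ω(a), M)·2^{Ω(a)}` then
  `∑ W ≤ min(H,M)·2^H · #{W > 0} + ∑_{H < h ≤ B} min(h,M)·2^h · T(h)`, `T(h) = #{a : Ω(a) ≥ h}`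
  (Irving: "`#{W>0} ≥ 2^{-H}/min(H,[1/δ]) (∑ W − ∑_{h>H} min(h,[1/δ]) 2^h T(h,δ))`"), and the
  divided form `Irving2015.card_pos_weight_ge`.
* `Irving2015.pow_card_largePrimeFactors_le` — §2 end: `z^{Ω_z(m)} ≤ m` (so `Ω_δ ≤ [3/δ]`,
  `T(h,δ) = 0` for large `h`), with `Ω_z(m)` the number of prime factors `≥ z` of `m` counted with
  multiplicity, written `((Nat.primeFactorsList m).filter (z ≤ ·)).length` throughout.
* `Irving2015.exists_dvd_of_le_card_largePrimeFactors` — Lemma 3.1 (p. 5): if `Ω_z(m) ≥ h` then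
  `m` has a divisor `d` with exactly `[h/3]` prime factors (with multiplicity), all `≥ z`, and
  `d³ ≤ m` (Irving: `d = p₁⋯p_k`, `d³ ≤ p₁⋯p_{k-1}p_k^{h-k+1} ≤ 9X³`; here via the three blocks of
  the `k` smallest, next `k`, next `k` large prime factors), and its specialisation
  `Irving2015.exists_dvd_cube_add_two` to `m = n³ + 2`, `n ∈ (X, 2X]`, giving `d < 3X`.
* `Irving2015.numerics_section5` — §5 (p. 8): `2^{-132}/132 · (9.2·10⁻⁸ − 3.7·10⁻⁸) · (1/321)/2
  > 10⁻⁵²` (the paper prints the intermediate value `7.7·10⁻⁵⁰`; the exact product is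
  `7.65…·10⁻⁵⁰`, and `αδ/2 = 1.19…·10⁻⁵² ≥ 10⁻⁵²` either way).
* `Irving2015_largestPrimeFactor_cubic_of_count_ge` — §5 last paragraph: a positive-proportion
  count with prime factors `p ≥ X^{1+ϖ'}` for some `ϖ' > 10⁻⁵²` (the shape Lemma 2.2 outputs, with
  `ϖ' = αδ/2`) implies the named fact (strict `>` at exponent `10⁻⁵²`).

## References

* A. J. Irving, *The largest prime factor of `X³ + 2`*, arXiv:1412.0024; Acta Arith. 171 (2015)
  67–80, §2, Lemma 3.1, §5. [`Irving2014LargestPrimeFactorCubic`]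
* D. R. Heath-Brown, *The largest prime factor of `X³ + 2`*, Proc. London Math. Soc. (3) 82 (2001)
  554–596. [`HeathBrown2001LargestPrimeFactorCubic`]
-/

noncomputable section

open Filter Finset

namespace Literature.NumberTheory.Sieve

namespace Irving2015

/-! ### §2: from the weighted sum `S = ∑ W` to the number of `n` with `W(n) > 0` -/

/-- **Irving 2015, §2** (arXiv pp. 4–5), the truncation inequality in division-free form: if every
weight satisfies `W(a) ≤ min(Ω(a), M)·2^{Ω(a)}` and `Ω ≤ B` on `s`, then for every `H`,
`∑_{a∈s} W(a) ≤ min(H,M)·2^H·#{a : W(a) > 0} + ∑_{H<h≤B} min(h,M)·2^h·#{a : Ω(a) ≥ h}`.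
(Irving: `#{W>0} ≥ #{W>0, Ω≤H} ≥ 2^{-H}/min(H,[1/δ]) ∑_{Ω≤H} W` and
`∑_{Ω>H} W ≤ ∑_{h>H} min(h,[1/δ]) 2^h T(h,δ)`, with `M = [1/δ]`, `B = [3/δ]`.)
[cite: Irving2014LargestPrimeFactorCubic, §2 (pp. 4–5 of arXiv:1412.0024)] -/
theorem sum_weight_le {α : Type*} [DecidableEq α] (s : Finset α) (W Ω : α → ℕ) (M H B : ℕ)
    (hW : ∀ a ∈ s, W a ≤ min (Ω a) M * 2 ^ Ω a) (hB : ∀ a ∈ s, Ω a ≤ B) :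
    ∑ a ∈ s, W a ≤ min H M * 2 ^ H * (s.filter fun a => 0 < W a).card
      + ∑ h ∈ Ioc H B, min h M * 2 ^ h * (s.filter fun a => h ≤ Ω a).card := by
  classical
  rw [← sum_filter_add_sum_filter_not s (fun a => Ω a ≤ H)]
  refine Nat.add_le_add ?_ ?_
  · -- terms with `Ω a ≤ H`: each nonzero weight is at most `min(H,M)·2^H`
    calc ∑ a ∈ s.filter (fun a => Ω a ≤ H), W a
        = ∑ a ∈ (s.filter (fun a => Ω a ≤ H)).filter (fun a => W a ≠ 0), W a :=
          (sum_filter_ne_zero _).symm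
      _ ≤ ((s.filter (fun a => Ω a ≤ H)).filter (fun a => W a ≠ 0)).card • (min H M * 2 ^ H) := by
          refine sum_le_card_nsmul _ _ _ (fun a ha => ?_)
          simp only [mem_filter] at ha
          obtain ⟨⟨has, hΩ⟩, -⟩ := ha
          refine (hW a has).trans (Nat.mul_le_mul ?_ ?_)
          · exact min_le_min_right _ hΩ
          · exact Nat.pow_le_pow_right (by norm_num) hΩ
      _ = min H M * 2 ^ H * ((s.filter (fun a => Ω a ≤ H)).filter (fun a => W a ≠ 0)).card := by
          rw [smul_eq_mul, Nat.mul_comm]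
      _ ≤ min H M * 2 ^ H * (s.filter fun a => 0 < W a).card := by
          refine Nat.mul_le_mul_left _ (card_le_card (fun a ha => ?_))
          simp only [mem_filter] at ha ⊢
          exact ⟨ha.1.1, Nat.pos_of_ne_zero ha.2⟩
  · -- terms with `Ω a > H`: sort by the value `h = Ω a ∈ (H, B]`
    have hmaps : ∀ a ∈ s.filter (fun a => ¬ Ω a ≤ H), Ω a ∈ Ioc H B := by
      intro a ha
      simp only [mem_filter, not_le] at ha
      exact mem_Ioc.2 ⟨ha.2, hB a ha.1⟩
    rw [← sum_fiberwise_of_maps_to hmaps]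
    refine sum_le_sum (fun h _ => ?_)
    calc ∑ a ∈ (s.filter (fun a => ¬ Ω a ≤ H)).filter (fun a => Ω a = h), W a
        ≤ ((s.filter (fun a => ¬ Ω a ≤ H)).filter (fun a => Ω a = h)).card • (min h M * 2 ^ h) := by
          refine sum_le_card_nsmul _ _ _ (fun a ha => ?_)
          simp only [mem_filter] at ha
          obtain ⟨⟨has, -⟩, hΩ⟩ := ha
          simpa [hΩ] using hW a has
      _ = min h M * 2 ^ h * ((s.filter (fun a => ¬ Ω a ≤ H)).filter (fun a => Ω a = h)).card := by
          rw [smul_eq_mul, Nat.mul_comm]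
      _ ≤ min h M * 2 ^ h * (s.filter fun a => h ≤ Ω a).card := by
          refine Nat.mul_le_mul_left _ (card_le_card (fun a ha => ?_))
          simp only [mem_filter] at ha ⊢
          exact ⟨ha.1.1, ha.2.ge⟩

/-- **Irving 2015, §2** (arXiv p. 5), the printed form: with `T(h) = #{a : Ω(a) ≥ h}`,
`#{a : W(a) > 0} ≥ (∑ W − ∑_{H<h≤B} min(h,M) 2^h T(h)) / (min(H,M)·2^H)` (real division;
`H, M ≥ 1`). [cite: Irving2014LargestPrimeFactorCubic, §2 (p. 5 of arXiv:1412.0024)] -/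
theorem card_pos_weight_ge {α : Type*} [DecidableEq α] (s : Finset α) (W Ω : α → ℕ) {M H : ℕ}
    (B : ℕ) (hM : 1 ≤ M) (hH : 1 ≤ H)
    (hW : ∀ a ∈ s, W a ≤ min (Ω a) M * 2 ^ Ω a) (hB : ∀ a ∈ s, Ω a ≤ B) :
    ((∑ a ∈ s, (W a : ℝ)) - ∑ h ∈ Ioc H B, (min h M : ℝ) * 2 ^ h * (s.filter fun a => h ≤ Ω a).card)
        / ((min H M : ℝ) * 2 ^ H) ≤ ((s.filter fun a => 0 < W a).card : ℝ) := by
  have hpos : (0 : ℝ) < (min H M : ℝ) * 2 ^ H := by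
    have : (1 : ℝ) ≤ (min H M : ℕ) := by exact_mod_cast le_min hH hM
    push_cast at this
    positivity
  rw [div_le_iff₀ hpos, sub_le_iff_le_add]
  have key := sum_weight_le s W Ω M H B hW hB
  have key' : ((∑ a ∈ s, W a : ℕ) : ℝ) ≤ ((min H M * 2 ^ H * (s.filter fun a => 0 < W a).card
      + ∑ h ∈ Ioc H B, min h M * 2 ^ h * (s.filter fun a => h ≤ Ω a).card : ℕ) : ℝ) := by
    exact_mod_cast key
  push_cast at key'
  linarith

/-! ### §2 (end): `Ω_z(m)`, the number of prime factors `≥ z` counted with multiplicity -/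

/-- **Irving 2015, §2** (arXiv p. 5: "`Ω_δ(n+∛2) ≤ [3/δ]` when `X` is large", i.e.
`(X^δ)^{Ω_δ} ≤ n³+2 ≤ 9X³`): for `m ≠ 0`, `z^{Ω_z(m)} ≤ m`, where
`Ω_z(m) = ((Nat.primeFactorsList m).filter (z ≤ ·)).length` is the number of prime factors of `m`
that are `≥ z`, counted with multiplicity.
[cite: Irving2014LargestPrimeFactorCubic, §2 (p. 5 of arXiv:1412.0024)] -/
theorem pow_card_largePrimeFactors_le {m : ℕ} (hm : m ≠ 0) (z : ℕ) :
    z ^ ((Nat.primeFactorsList m).filter (fun p => z ≤ p)).length ≤ m := by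
  set L := (Nat.primeFactorsList m).filter (fun p => z ≤ p) with hL
  have hsub : L.Sublist (Nat.primeFactorsList m) := List.filter_sublist
  have h1 : ∀ p ∈ Nat.primeFactorsList m, 1 ≤ p :=
    fun p hp => (Nat.prime_of_mem_primeFactorsList hp).one_lt.le
  calc z ^ L.length = (L.map fun _ => z).prod := by simp
    _ ≤ (L.map id).prod := by
        refine List.prod_le_prod' (fun p hp => ?_)
        simpa using (List.mem_filter.1 hp).2
    _ = L.prod := by simp
    _ ≤ (Nat.primeFactorsList m).prod := hsub.prod_le_prod' h1
    _ = m := Nat.prod_primeFactorsList hm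

/-- Consequently `Ω_z(m) < h` as soon as `m < z^h` (Irving: `T(h,δ) = 0` for `h > 963` when
`δ = 1/321`). [cite: Irving2014LargestPrimeFactorCubic, §5 (p. 8 of arXiv:1412.0024)] -/
theorem card_largePrimeFactors_lt {m z h : ℕ} (hm : m ≠ 0) (hz : 1 < z) (hmz : m < z ^ h) :
    ((Nat.primeFactorsList m).filter (fun p => z ≤ p)).length < h := by
  have := pow_card_largePrimeFactors_le hm z
  exact (Nat.pow_lt_pow_iff_right hz).1 (this.trans_lt hmz)

/-! ### Lemma 3.1: the divisor `d = p₁ ⋯ p_k`, `k = [h/3]`, of an `m` with `Ω_z(m) ≥ h` -/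

/-- Pairing lemma: if `|A| ≤ |S|` and every element of `A` is `≤` every element of `S`, then `A` is
termwise `≤` a sublist of `S`. [folklore] -/
theorem sublistForall₂_of_forall_mem_le :
    ∀ {A S : List ℕ}, A.length ≤ S.length → (∀ a ∈ A, ∀ b ∈ S, a ≤ b) →
      List.SublistForall₂ (· ≤ ·) A S
  | [], _, _, _ => List.SublistForall₂.nil
  | _ :: _, [], h, _ => by simp at h
  | a :: A, b :: S, h, hrel => by
      refine List.SublistForall₂.cons (hrel a (by simp) b (by simp))
        (sublistForall₂_of_forall_mem_le (by simpa using h) ?_)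
      intro a' ha' b' hb'
      exact hrel a' (by simp [ha']) b' (by simp [hb'])

/-- Block inequality behind Lemma 3.1: for a sorted list of positive integers of length `≥ 3k`,
the cube of the product of its `k` smallest entries is at most the whole product (compare the
first block termwise with the second and with the third block of `k` entries).
[cite: Irving2014LargestPrimeFactorCubic, Lemma 3.1 (proof)] -/
theorem prod_take_pow_three_le_prod {l : List ℕ} (hl : l.Pairwise (· ≤ ·)) (h1 : ∀ x ∈ l, 1 ≤ x)
    {k : ℕ} (hk : 3 * k ≤ l.length) : (l.take k).prod ^ 3 ≤ l.prod := by
  set A := l.take k with hA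
  set R := l.drop k with hR
  have hAR : A ++ R = l := List.take_append_drop k l
  have hrel : ∀ a ∈ A, ∀ r ∈ R, a ≤ r := by
    have h' := hl
    rw [← hAR, List.pairwise_append] at h'
    exact h'.2.2
  have hlenA : A.length = k := by rw [hA, List.length_take]; omega
  have hlenR : R.length = l.length - k := by rw [hR, List.length_drop]
  have h1R : ∀ r ∈ R, 1 ≤ r := fun r hr => h1 r (List.mem_of_mem_drop hr)
  have key : ∀ S : List ℕ, k ≤ S.length → (∀ a ∈ A, ∀ b ∈ S, a ≤ b) → (∀ b ∈ S, 1 ≤ b) →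
      A.prod ≤ S.prod := fun S hS hAS hS1 =>
    (sublistForall₂_of_forall_mem_le (hlenA.le.trans hS) hAS).prod_le_prod' hS1
  have hB : A.prod ≤ (R.take k).prod :=
    key _ (by rw [List.length_take, hlenR]; omega)
      (fun a ha b hb => hrel a ha b (List.mem_of_mem_take hb))
      (fun b hb => h1R b (List.mem_of_mem_take hb))
  have hC : A.prod ≤ (R.drop k).prod :=
    key _ (by rw [List.length_drop, hlenR]; omega)
      (fun a ha b hb => hrel a ha b (List.mem_of_mem_drop hb))
      (fun b hb => h1R b (List.mem_of_mem_drop hb))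
  calc A.prod ^ 3 = A.prod * (A.prod * A.prod) := by ring
    _ ≤ A.prod * ((R.take k).prod * (R.drop k).prod) :=
        Nat.mul_le_mul_left _ (Nat.mul_le_mul hB hC)
    _ = l.prod := by rw [← List.prod_append, List.take_append_drop, ← List.prod_append, hAR]

/-- **Irving 2015, Lemma 3.1** (arithmetic core, arXiv p. 5): if `m ≠ 0` has at least `h` prime
factors `≥ z` counted with multiplicity, then `m` has a divisor `d` with exactly `[h/3]` prime
factors counted with multiplicity (`Ω(d) = [h/3]`), all of them `≥ z`, and `d³ ≤ m` (Irving: the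
product of the `[h/3]` smallest prime factors `≥ X^δ`; "`d³ ≤ p₁⋯p_{k-1}p_k^{2k+1} ≤ … ≤ 9X³` and
thus `d ≪ X`"). [cite: Irving2014LargestPrimeFactorCubic, Lemma 3.1] -/
theorem exists_dvd_of_le_card_largePrimeFactors {m z h : ℕ} (hm : m ≠ 0)
    (hh : h ≤ ((Nat.primeFactorsList m).filter (fun p => z ≤ p)).length) :
    ∃ d : ℕ, d ∣ m ∧ d ^ 3 ≤ m ∧ ArithmeticFunction.cardFactors d = h / 3 ∧
      ∀ p : ℕ, p.Prime → p ∣ d → z ≤ p := by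
  set L := (Nat.primeFactorsList m).filter (fun p => z ≤ p) with hL
  set k := h / 3 with hk
  have hsubL : L.Sublist (Nat.primeFactorsList m) := List.filter_sublist
  have hprimeL : ∀ p ∈ L, p.Prime := fun p hp => Nat.prime_of_mem_primeFactorsList (hsubL.subset hp)
  have hsorted : L.Pairwise (· ≤ ·) := (Nat.primeFactorsList_sorted m).pairwise.sublist hsubL
  have h1 : ∀ p ∈ L, 1 ≤ p := fun p hp => (hprimeL p hp).one_lt.le
  have hkL : 3 * k ≤ L.length := by omega
  have hprimek : ∀ p ∈ L.take k, p.Prime := fun p hp => hprimeL p (List.mem_of_mem_take hp)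
  refine ⟨(L.take k).prod, ?_, ?_, ?_, ?_⟩
  · -- `d ∣ m`
    calc (L.take k).prod ∣ (Nat.primeFactorsList m).prod :=
          ((List.take_sublist k L).trans hsubL).prod_dvd_prod
      _ = m := Nat.prod_primeFactorsList hm
  · -- `d³ ≤ m`
    calc (L.take k).prod ^ 3 ≤ L.prod := prod_take_pow_three_le_prod hsorted h1 hkL
      _ ≤ (Nat.primeFactorsList m).prod :=
          hsubL.prod_le_prod' (fun p hp => (Nat.prime_of_mem_primeFactorsList hp).one_lt.le)
      _ = m := Nat.prod_primeFactorsList hm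
  · -- `Ω(d) = k`: the prime factorisation of `d` is (a permutation of) `L.take k`
    have hperm := Nat.primeFactorsList_unique (n := (L.take k).prod) rfl hprimek
    rw [ArithmeticFunction.cardFactors_apply, ← hperm.length_eq, List.length_take]
    omega
  · -- the prime factors of `d` are `≥ z`
    intro p hp hpd
    obtain ⟨q, hq, hpq⟩ := (Prime.dvd_prod_iff hp.prime).1 hpd
    obtain rfl : p = q := (Nat.prime_dvd_prime_iff_eq hp (hprimek q hq)).1 hpq
    simpa using (List.mem_filter.1 (List.mem_of_mem_take hq)).2

/-- **Irving 2015, Lemma 3.1** for the values `n³ + 2`, `n ∈ (X, 2X]` (arXiv p. 5; the bound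
`d ≤ 3X` is the form used in Lemma 4.1): if `n³ + 2` has at least `h` prime factors `≥ z` counted
with multiplicity, it has a divisor `d < 3X` with `Ω(d) = [h/3]` all of whose prime factors are
`≥ z`. [cite: Irving2014LargestPrimeFactorCubic, Lemma 3.1 and Lemma 4.1] -/
theorem exists_dvd_cube_add_two {X n z h : ℕ} (hn : n ∈ Ioc X (2 * X))
    (hh : h ≤ ((Nat.primeFactorsList (n ^ 3 + 2)).filter (fun p => z ≤ p)).length) :
    ∃ d : ℕ, d ∣ n ^ 3 + 2 ∧ d < 3 * X ∧ ArithmeticFunction.cardFactors d = h / 3 ∧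
      ∀ p : ℕ, p.Prime → p ∣ d → z ≤ p := by
  obtain ⟨d, hd, hd3, hΩ, hz⟩ := exists_dvd_of_le_card_largePrimeFactors (by positivity) hh
  refine ⟨d, hd, ?_, hΩ, hz⟩
  rw [mem_Ioc] at hn
  have hX : 1 ≤ X := by omega
  have h3 : d ^ 3 < (3 * X) ^ 3 := by
    calc d ^ 3 ≤ n ^ 3 + 2 := hd3
      _ ≤ (2 * X) ^ 3 + 2 := by gcongr; exact hn.2
      _ < (3 * X) ^ 3 := by
          have hx3 : 1 ≤ X ^ 3 := Nat.one_le_pow _ _ hX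
          have e1 : (2 * X) ^ 3 + 2 = 8 * X ^ 3 + 2 := by ring
          have e2 : (3 * X) ^ 3 = 27 * X ^ 3 := by ring
          rw [e1, e2]
          generalize X ^ 3 = Y at hx3
          omega
  exact lt_of_pow_lt_pow_left₀ 3 (by positivity) h3

/-! ### §5: the numerical constants -/

/-- **Irving 2015, §5** (arXiv p. 8): with `H = 132`, Heath-Brown's `S ≥ (9.2·10⁻⁸ + o(1))X`
(Lemma 2.3) and the tail bound `∑_{h>132} min(h,321) 2^h T(h,δ) ≤ (3.7·10⁻⁸ + o(1))X`, the
proportion `α = 2^{-132}/132 · (9.2·10⁻⁸ − 3.7·10⁻⁸)` and `δ = 1/321` give an exponent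
`αδ/2 > 10⁻⁵²` (Irving prints `α ≥ 7.7·10⁻⁵⁰`, `αδ/2 = 1.2·10⁻⁵²`; exactly,
`α = 7.65…·10⁻⁵⁰` and `αδ/2 = 1.19…·10⁻⁵²`). [cite: Irving2014LargestPrimeFactorCubic, §5] -/
theorem numerics_section5 :
    (1 : ℝ) / 10 ^ 52 <
      ((2 : ℝ) ^ 132)⁻¹ / 132 * (9.2 / 10 ^ 8 - 3.7 / 10 ^ 8) * (1 / 321) / 2 := by
  norm_num

/-- The intermediate value of §5 as printed is rounded up: `2^{-132}/132 · 5.5·10⁻⁸ < 7.7·10⁻⁵⁰`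
(it is `7.65…·10⁻⁵⁰`); the conclusion `αδ/2 ≥ 10⁻⁵²` of `numerics_section5` is unaffected.
[cite: Irving2014LargestPrimeFactorCubic, §5] -/
theorem numerics_section5_printed_intermediate :
    ((2 : ℝ) ^ 132)⁻¹ / 132 * (9.2 / 10 ^ 8 - 3.7 / 10 ^ 8) < 7.7 / 10 ^ 50 ∧
      (7.6 : ℝ) / 10 ^ 50 < ((2 : ℝ) ^ 132)⁻¹ / 132 * (9.2 / 10 ^ 8 - 3.7 / 10 ^ 8) := by
  constructor <;> norm_num

end Irving2015

/-! ### §5 (last paragraph): from the output of Lemma 2.2 to Theorem 1.1 -/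

open scoped Classical in
/-- **Irving 2015, §5**, last step (arXiv p. 8: "apply Lemma 2.2 with `δ = 1/321` and
`α = 7.7·10⁻⁵⁰` to deduce that Theorem 1.1 holds when `ϖ ≤ αδ/2 = 1.2·10⁻⁵²`, so in particular when
`ϖ ≤ 10⁻⁵²`"): a count of `≥ cX` integers `n ∈ (X, 2X]` with a prime factor `p ≥ X^{1+ϖ'}` of
`n³ + 2`, for some `ϖ' > 10⁻⁵²` and all large `X` (the shape of Lemma 2.2's conclusion, prime ideal
factors of `n + ∛2` of norm `p = N(P) ≥ X^{1+αδ/2}` being prime factors of `N(n+∛2) = n³ + 2`),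
implies the named fact `Irving2015_largestPrimeFactor_cubic` (strict inequality at the smaller
exponent, `X > 1`). [cite: Irving2014LargestPrimeFactorCubic, §5 and Thm. 1.1] -/
theorem Irving2015_largestPrimeFactor_cubic_of_count_ge {ϖ' c : ℝ} (hϖ : (1 : ℝ) / 10 ^ 52 < ϖ')
    (hc : 0 < c)
    (h : ∀ᶠ X : ℕ in atTop, c * X ≤
      (((Ioc X (2 * X)).filter fun n =>
          ∃ p : ℕ, p.Prime ∧ p ∣ n ^ 3 + 2 ∧ (X : ℝ) ^ (1 + ϖ') ≤ p).card : ℝ)) :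
    Irving2015_largestPrimeFactor_cubic := by
  refine ⟨c, hc, ?_⟩
  filter_upwards [h, eventually_gt_atTop 1] with X hX h1
  refine hX.trans ?_
  have hle : ((Ioc X (2 * X)).filter fun n =>
        ∃ p : ℕ, p.Prime ∧ p ∣ n ^ 3 + 2 ∧ (X : ℝ) ^ (1 + ϖ') ≤ p).card
      ≤ cubicLargePrimeFactorCount (1 / 10 ^ 52) X := by
    unfold cubicLargePrimeFactorCount
    refine card_le_card (fun n hn => ?_)
    simp only [mem_filter] at hn ⊢
    obtain ⟨hn, p, hp, hdvd, hle⟩ := hn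
    refine ⟨hn, p, hp, hdvd, lt_of_lt_of_le ?_ hle⟩
    have hX1 : (1 : ℝ) < X := by exact_mod_cast h1
    exact Real.rpow_lt_rpow_of_exponent_lt hX1 (by linarith)
  exact_mod_cast hle

end Literature.NumberTheory.Sieve
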